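import Mathlib
import HarnessLib

/-!
# Lattice-point counting and power sums on `ℤ^d` with the sup norm

Support file for the proof of Bass–Levin 2002, Theorem 1.1
(`Literature.Probability.Process.bassLevin_thm_1_1`). We record elementary facts about the
sup norm `‖h‖ = maxᵢ |hᵢ|` on `Fin d → ℤ` (it takes natural-number values, the box
`{‖h‖ ≤ R}` is `Fintype.piFinset fun _ => Finset.Icc (-R) R` of cardinality `(2R+1)^d`, the
shell `{‖h‖ = k}` has at most `2d(2k+1)^{d-1}` points) and the resulting bounds on lattice power
sums used throughout the heat-kernel estimates:

* `sum_norm_rpow_le_of_norm_gt` : `∑_{h ∈ s} ‖h‖^{-t} ≤ C r^{d-t}` for finite `s ⊆ {‖h‖ > r}`,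
  `t > d` (tails of the jump kernel, `∑_{|h|>r} |h|^{-(d+α)} ≍ r^{-α}`);
* `sum_norm_rpow_le_of_norm_le` : `∑_{h ∈ s} ‖h‖^{γ} ≤ C r^{d+γ}` for finite
  `s ⊆ {0 < ‖h‖ ≤ r}`, `γ > -d`;
* one-dimensional telescoping bounds `∑_{r<k≤N} k^{-1-a} ≤ r^{-a}/a` and
  `∑_{1≤k≤r} k^{e} ≤ (1 + 1/(e+1)) r^{e+1}`.

Everything here is elementary. [folklore]

## References
* R. F. Bass, D. A. Levin, *Transition probabilities for symmetric jump processes*,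
  Trans. Amer. Math. Soc. 354 (2002) 2933–2953 (these sums are used tacitly throughout §§2–5).
-/

noncomputable section

namespace Literature.Probability.Process

open scoped BigOperators

section OneDim

/-- Convexity bound `1 + a t ≤ (1 - t)^{-a}` for `a ≥ 0`, `t < 1`. [folklore] -/
theorem one_add_mul_le_one_sub_rpow_neg {a t : ℝ} (ha : 0 ≤ a) (ht1 : t < 1) :
    1 + a * t ≤ (1 - t) ^ (-a) := by
  have h1t : 0 < 1 - t := by linarith
  have hexp : Real.exp t ≤ (1 - t)⁻¹ := by
    rw [le_inv_comm₀ (Real.exp_pos t) h1t, ← Real.exp_neg]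
    exact Real.one_sub_le_exp_neg t
  calc 1 + a * t ≤ Real.exp (t * a) := by linarith [Real.add_one_le_exp (t * a)]
    _ = Real.exp t ^ a := Real.exp_mul t a
    _ ≤ ((1 - t)⁻¹) ^ a := Real.rpow_le_rpow (Real.exp_pos t).le hexp ha
    _ = (1 - t) ^ (-a) := by rw [Real.inv_rpow h1t.le, Real.rpow_neg h1t.le]

/-- Telescoping step for `p`-series tails: `a (k+1)^{-a-1} ≤ k^{-a} - (k+1)^{-a}` (`a > 0`,
`k ≥ 1`). [folklore] -/
theorem mul_rpow_neg_succ_le_sub {a : ℝ} (ha : 0 < a) {k : ℕ} (hk : 1 ≤ k) :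
    a * ((k : ℝ) + 1) ^ (-a - 1) ≤ (k : ℝ) ^ (-a) - ((k : ℝ) + 1) ^ (-a) := by
  have hx : (0 : ℝ) < (k : ℝ) + 1 := by positivity
  have hk0 : (0 : ℝ) < k := by exact_mod_cast hk
  set x : ℝ := (k : ℝ) + 1 with hxdef
  have ht0 : 0 ≤ 1 / x := by positivity
  have ht1 : 1 / x < 1 := by rw [div_lt_one hx]; linarith
  have hkx : (k : ℝ) = x * (1 - 1 / x) := by field_simp; ring
  have hmain : x ^ (-a) * (1 + a * (1 / x)) ≤ (k : ℝ) ^ (-a) := by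
    rw [hkx, Real.mul_rpow hx.le (by linarith)]
    exact mul_le_mul_of_nonneg_left (one_add_mul_le_one_sub_rpow_neg ha.le ht1)
      (Real.rpow_nonneg hx.le _)
  have hsplit : x ^ (-a - 1) = x ^ (-a) * (1 / x) := by
    rw [sub_eq_add_neg, Real.rpow_add hx, Real.rpow_neg_one, one_div]
  rw [hsplit]
  nlinarith [hmain, Real.rpow_nonneg hx.le (-a)]

/-- Tail of a `p`-series: `∑_{r < k ≤ N} k^{-1-a} ≤ r^{-a} / a` for `a > 0`, `r ≥ 1`. [folklore] -/
theorem sum_Ioc_rpow_neg_le {a : ℝ} (ha : 0 < a) {r : ℕ} (hr : 1 ≤ r) (N : ℕ) :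
    ∑ k ∈ Finset.Ioc r N, (k : ℝ) ^ (-1 - a) ≤ (r : ℝ) ^ (-a) / a := by
  -- stronger invariant: a * (partial sum) ≤ r^{-a} - N^{-a} for N ≥ r
  suffices h : ∀ N, r ≤ N → a * ∑ k ∈ Finset.Ioc r N, (k : ℝ) ^ (-1 - a) ≤
      (r : ℝ) ^ (-a) - (N : ℝ) ^ (-a) by
    by_cases hN : r ≤ N
    · have h' := h N hN
      have : 0 ≤ (N : ℝ) ^ (-a) := Real.rpow_nonneg (Nat.cast_nonneg N) _
      rw [le_div_iff₀ ha, mul_comm]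
      linarith
    · rw [Finset.Ioc_eq_empty (by omega), Finset.sum_empty]
      positivity
  intro N hN
  induction N, hN using Nat.le_induction with
  | base => simp
  | succ N hN ih =>
    rw [Finset.sum_Ioc_succ_top hN, mul_add]
    have hstep := mul_rpow_neg_succ_le_sub ha (hr.trans hN)
    have hcast : ((N + 1 : ℕ) : ℝ) = (N : ℝ) + 1 := by push_cast; ring
    rw [hcast]
    have : ((N : ℝ) + 1) ^ (-1 - a) = ((N : ℝ) + 1) ^ (-a - 1) := by ring_nf
    rw [this]
    linarith

/-- Telescoping step for concave powers: `(e+1) k^{e} ≤ k^{e+1} - (k-1)^{e+1}` for `-1 < e < 0`,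
`k ≥ 1`. [folklore] -/
theorem mul_rpow_le_sub_of_neg {e : ℝ} (he : -1 < e) (he0 : e ≤ 0) {k : ℕ} (hk : 1 ≤ k) :
    (e + 1) * (k : ℝ) ^ e ≤ (k : ℝ) ^ (e + 1) - ((k : ℝ) - 1) ^ (e + 1) := by
  have hk0 : (0 : ℝ) < k := by exact_mod_cast hk
  have hs : (-1 : ℝ) ≤ -(1 / k) := by
    have : (1 : ℝ) / k ≤ 1 := by rw [div_le_one hk0]; exact_mod_cast hk
    linarith
  have hb := rpow_one_add_le_one_add_mul_self hs (by linarith : 0 ≤ e + 1) (by linarith : e + 1 ≤ 1)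
  have hkm : (k : ℝ) - 1 = k * (1 + -(1 / k)) := by field_simp; ring
  have h1 : ((k : ℝ) - 1) ^ (e + 1) ≤ (k : ℝ) ^ (e + 1) * (1 + (e + 1) * -(1 / k)) := by
    rw [hkm, Real.mul_rpow hk0.le (by linarith)]
    exact mul_le_mul_of_nonneg_left hb (Real.rpow_nonneg hk0.le _)
  have h2 : (k : ℝ) ^ (e + 1) * (1 + (e + 1) * -(1 / k)) = (k : ℝ) ^ (e + 1) - (e + 1) * (k : ℝ) ^ e := by
    rw [Real.rpow_add_one hk0.ne']
    field_simp
    ring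
  linarith

/-- Power sums with exponent `e > -1`: `∑_{1 ≤ k ≤ r} k^{e} ≤ (1 + 1/(e+1)) r^{e+1}`. [folklore] -/
theorem sum_Icc_rpow_le {e : ℝ} (he : -1 < e) (r : ℕ) :
    ∑ k ∈ Finset.Icc 1 r, (k : ℝ) ^ e ≤ (1 + 1 / (e + 1)) * (r : ℝ) ^ (e + 1) := by
  have he1 : 0 < e + 1 := by linarith
  have hr0 : (0 : ℝ) ≤ r := Nat.cast_nonneg r
  have hpow : 0 ≤ (r : ℝ) ^ (e + 1) := Real.rpow_nonneg hr0 _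
  rcases le_or_gt 0 e with he0 | he0
  · -- each term ≤ r^e, and there are r terms
    have hterm : ∀ k ∈ Finset.Icc 1 r, (k : ℝ) ^ e ≤ (r : ℝ) ^ e := by
      intro k hk
      have hk := Finset.mem_Icc.mp hk
      exact Real.rpow_le_rpow (Nat.cast_nonneg k) (by exact_mod_cast hk.2) he0
    calc ∑ k ∈ Finset.Icc 1 r, (k : ℝ) ^ e ≤ ∑ k ∈ Finset.Icc 1 r, (r : ℝ) ^ e :=
          Finset.sum_le_sum hterm
      _ = (r : ℝ) * (r : ℝ) ^ e := by simp
      _ = (r : ℝ) ^ (e + 1) := by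
          rcases Nat.eq_zero_or_pos r with hr | hr
          · subst hr; simp [Real.zero_rpow he1.ne']
          · rw [Real.rpow_add_one (by positivity : (r : ℝ) ≠ 0)]; ring
      _ ≤ (1 + 1 / (e + 1)) * (r : ℝ) ^ (e + 1) := by
          have : 0 ≤ 1 / (e + 1) := by positivity
          nlinarith
  · -- telescoping
    have hterm : ∀ k ∈ Finset.Icc 1 r, (k : ℝ) ^ e ≤
        ((k : ℝ) ^ (e + 1) - ((k : ℝ) - 1) ^ (e + 1)) / (e + 1) := by
      intro k hk
      have hk := (Finset.mem_Icc.mp hk).1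
      rw [le_div_iff₀ he1, mul_comm]
      exact mul_rpow_le_sub_of_neg he he0.le hk
    have htel : ∀ n : ℕ, ∑ k ∈ Finset.Icc 1 n, ((k : ℝ) ^ (e + 1) - ((k : ℝ) - 1) ^ (e + 1)) =
        (n : ℝ) ^ (e + 1) := by
      intro n
      induction n with
      | zero => simp [Real.zero_rpow he1.ne']
      | succ n ih =>
        rw [Finset.sum_Icc_succ_top (by omega), ih]
        push_cast
        ring
    calc ∑ k ∈ Finset.Icc 1 r, (k : ℝ) ^ e
        ≤ ∑ k ∈ Finset.Icc 1 r, ((k : ℝ) ^ (e + 1) - ((k : ℝ) - 1) ^ (e + 1)) / (e + 1) :=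
          Finset.sum_le_sum hterm
      _ = (r : ℝ) ^ (e + 1) / (e + 1) := by rw [← Finset.sum_div, htel]
      _ ≤ (1 + 1 / (e + 1)) * (r : ℝ) ^ (e + 1) := by
          rw [div_eq_mul_one_div, mul_comm]
          nlinarith

end OneDim

section Norm

variable {d : ℕ}

/-- The sup norm of an integer vector is the cast of a natural number (the maximum of the absolute
values of the coordinates). [folklore] -/
theorem norm_eq_natCast_sup (h : Fin d → ℤ) :
    ‖h‖ = ((Finset.univ.sup fun i => (h i).natAbs : ℕ) : ℝ) := by
  rw [Pi.norm_def]
  have h1 : (fun i => ‖h i‖₊) = fun i => ((h i).natAbs : NNReal) := by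
    funext i; exact (NNReal.natCast_natAbs (h i)).symm
  rw [h1, ← Nat.cast_finsetSup]
  exact NNReal.coe_natCast _

/-- The sup norm of an integer vector is a natural number. [folklore] -/
theorem exists_norm_eq_natCast (h : Fin d → ℤ) : ∃ k : ℕ, ‖h‖ = k :=
  ⟨_, norm_eq_natCast_sup h⟩

/-- `‖h‖ ≤ R` iff every coordinate has absolute value `≤ R`. [folklore] -/
theorem norm_le_natCast_iff (h : Fin d → ℤ) (R : ℕ) : ‖h‖ ≤ R ↔ ∀ i, |h i| ≤ (R : ℤ) := by
  rw [pi_norm_le_iff_of_nonneg (Nat.cast_nonneg R)]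
  refine forall_congr' fun i => ?_
  rw [Int.norm_eq_abs]
  constructor
  · intro hi; exact_mod_cast hi
  · intro hi; exact_mod_cast hi

/-- Membership in the box `∏ [-R, R]` is `‖h‖ ≤ R`. [folklore] -/
theorem mem_box_iff (h : Fin d → ℤ) (R : ℕ) :
    h ∈ Fintype.piFinset (fun _ : Fin d => Finset.Icc (-(R : ℤ)) R) ↔ ‖h‖ ≤ R := by
  rw [norm_le_natCast_iff, Fintype.mem_piFinset]
  refine forall_congr' fun i => ?_
  rw [Finset.mem_Icc, abs_le]

/-- The box `∏ [-R, R] ⊂ ℤ^d` has `(2R+1)^d` points. [folklore] -/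
theorem card_box (d R : ℕ) :
    (Fintype.piFinset (fun _ : Fin d => Finset.Icc (-(R : ℤ)) R)).card = (2 * R + 1) ^ d := by
  rw [Fintype.card_piFinset, Finset.prod_const, Finset.card_univ, Fintype.card_fin]
  congr 1
  rw [Int.card_Icc]
  have : (R : ℤ) + 1 - -(R : ℤ) = ((2 * R + 1 : ℕ) : ℤ) := by push_cast; ring
  rw [this, Int.toNat_natCast]

/-- Boxes are monotone in the radius. [folklore] -/
theorem box_mono {R R' : ℕ} (hRR' : R ≤ R') :
    Fintype.piFinset (fun _ : Fin d => Finset.Icc (-(R : ℤ)) R) ⊆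
      Fintype.piFinset (fun _ : Fin d => Finset.Icc (-(R' : ℤ)) R') := by
  intro h hh
  rw [mem_box_iff] at hh ⊢
  exact hh.trans (by exact_mod_cast hRR')

/-- A nonzero integer vector has sup norm at least `1`. [folklore] -/
theorem one_le_norm_of_ne_zero {h : Fin d → ℤ} (hh : h ≠ 0) : 1 ≤ ‖h‖ := by
  obtain ⟨k, hk⟩ := exists_norm_eq_natCast h
  have hpos : 0 < ‖h‖ := norm_pos_iff.mpr hh
  rw [hk] at hpos ⊢
  have : 0 < k := by exact_mod_cast hpos
  exact_mod_cast this

/-- For a real radius `D ≥ 0`, `‖h‖ ≤ D` iff `‖h‖ ≤ ⌊D⌋₊` (the norm is an integer). [folklore] -/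
theorem norm_le_iff_norm_le_floor (h : Fin d → ℤ) {D : ℝ} (hD : 0 ≤ D) :
    ‖h‖ ≤ D ↔ ‖h‖ ≤ (⌊D⌋₊ : ℝ) := by
  obtain ⟨k, hk⟩ := exists_norm_eq_natCast h
  rw [hk]
  constructor
  · intro hkD
    exact_mod_cast Nat.le_floor hkD
  · intro hkD
    exact hkD.trans (Nat.floor_le hD)

/-- Every finite set of lattice points lies in some box. [folklore] -/
theorem exists_subset_box (s : Finset (Fin d → ℤ)) :
    ∃ N : ℕ, s ⊆ Fintype.piFinset (fun _ : Fin d => Finset.Icc (-(N : ℤ)) N) := by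
  refine ⟨s.sup fun h => Finset.univ.sup fun i => (h i).natAbs, fun h hh => ?_⟩
  rw [mem_box_iff, norm_eq_natCast_sup]
  exact_mod_cast Finset.le_sup (f := fun h => Finset.univ.sup fun i => (h i).natAbs) hh

/-- In the shell `box (N+1) \ box N` the norm equals `N+1`. [folklore] -/
theorem norm_eq_of_mem_shell {N : ℕ} {h : Fin d → ℤ}
    (h1 : h ∈ Fintype.piFinset (fun _ : Fin d => Finset.Icc (-((N + 1 : ℕ) : ℤ)) (N + 1 : ℕ)))
    (h2 : h ∉ Fintype.piFinset (fun _ : Fin d => Finset.Icc (-(N : ℤ)) N)) :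
    ‖h‖ = (N : ℝ) + 1 := by
  rw [mem_box_iff] at h1 h2
  obtain ⟨k, hk⟩ := exists_norm_eq_natCast h
  rw [hk] at h1 h2 ⊢
  push Not at h2
  have hk1 : k ≤ N + 1 := by exact_mod_cast h1
  have hk2 : N < k := by exact_mod_cast h2
  have : k = N + 1 := by omega
  subst this
  push_cast
  ring

/-- `a^{n+1} - b^{n+1} ≤ (n+1)(a-b)a^n` for `0 ≤ b ≤ a`. [folklore] -/
theorem pow_succ_sub_pow_succ_le {a b : ℝ} (hb : 0 ≤ b) (hab : b ≤ a) (n : ℕ) :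
    a ^ (n + 1) - b ^ (n + 1) ≤ (n + 1) * (a - b) * a ^ n := by
  induction n with
  | zero => simp
  | succ n ih =>
    have ha : 0 ≤ a := hb.trans hab
    have hbn : b ^ (n + 1) ≤ a ^ (n + 1) := pow_le_pow_left₀ hb hab _
    have hexp : a ^ (n + 1 + 1) - b ^ (n + 1 + 1) =
        a * (a ^ (n + 1) - b ^ (n + 1)) + (a - b) * b ^ (n + 1) := by ring
    rw [hexp]
    have h1 : a * (a ^ (n + 1) - b ^ (n + 1)) ≤ a * ((n + 1) * (a - b) * a ^ n) :=
      mul_le_mul_of_nonneg_left ih ha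
    have h2 : (a - b) * b ^ (n + 1) ≤ (a - b) * a ^ (n + 1) :=
      mul_le_mul_of_nonneg_left hbn (by linarith)
    calc _ ≤ a * ((n + 1) * (a - b) * a ^ n) + (a - b) * a ^ (n + 1) := add_le_add h1 h2
      _ = (((n + 1 : ℕ) : ℝ) + 1) * (a - b) * a ^ (n + 1) := by push_cast; ring

/-- The shell `{‖h‖ = k}` of `ℤ^d` has at most `2 d 3^{d-1} k^{d-1}` points (`k ≥ 1`). [folklore] -/
theorem card_shell_le {k : ℕ} (hk : 1 ≤ k) :
    ((Fintype.piFinset (fun _ : Fin d => Finset.Icc (-(k : ℤ)) k) \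
        Fintype.piFinset (fun _ : Fin d => Finset.Icc (-((k - 1 : ℕ) : ℤ)) (k - 1 : ℕ))).card : ℝ)
      ≤ 2 * d * 3 ^ (d - 1) * (k : ℝ) ^ (d - 1) := by
  rw [Finset.card_sdiff_of_subset (box_mono (Nat.sub_le k 1)), card_box, card_box]
  have hle : (2 * (k - 1) + 1) ^ d ≤ (2 * k + 1) ^ d := Nat.pow_le_pow_left (by omega) d
  rcases Nat.eq_zero_or_pos d with hd | hd
  · subst hd; simp
  rw [Nat.cast_sub hle]
  obtain ⟨n, rfl⟩ : ∃ n, d = n + 1 := ⟨d - 1, by omega⟩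
  have hk1 : ((k - 1 : ℕ) : ℝ) = (k : ℝ) - 1 := by rw [Nat.cast_sub hk]; simp
  push_cast
  rw [hk1]
  have h := pow_succ_sub_pow_succ_le (a := 2 * (k : ℝ) + 1) (b := 2 * ((k : ℝ) - 1) + 1)
    (by have : (1 : ℝ) ≤ k := by exact_mod_cast hk
        linarith) (by linarith) n
  have h3 : (2 * (k : ℝ) + 1) ^ n ≤ (3 * (k : ℝ)) ^ n := by
    apply pow_le_pow_left₀ (by positivity)
    have : (1 : ℝ) ≤ k := by exact_mod_cast hk
    linarith
  calc (2 * (k : ℝ) + 1) ^ (n + 1) - (2 * ((k : ℝ) - 1) + 1) ^ (n + 1)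
      ≤ (n + 1) * ((2 * (k : ℝ) + 1) - (2 * ((k : ℝ) - 1) + 1)) * (2 * (k : ℝ) + 1) ^ n := h
    _ = 2 * ((n : ℝ) + 1) * (2 * (k : ℝ) + 1) ^ n := by ring
    _ ≤ 2 * ((n : ℝ) + 1) * (3 * (k : ℝ)) ^ n := by
        apply mul_le_mul_of_nonneg_left h3; positivity
    _ = 2 * ((n : ℝ) + 1) * 3 ^ n * (k : ℝ) ^ n := by rw [mul_pow]; ring

/-- **Shell decomposition bound.** If `0 ≤ f h ≤ F ‖h‖` (for `‖h‖ ≥ 1`), then the sum of `f` over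
the lattice points with `r < ‖h‖ ≤ N` is at most `∑_{r<k≤N} 2 d 3^{d-1} k^{d-1} F k`. [folklore] -/
theorem sum_box_sdiff_box_le {f : (Fin d → ℤ) → ℝ} {F : ℕ → ℝ}
    (hfF : ∀ h (k : ℕ), 1 ≤ k → ‖h‖ = k → f h ≤ F k) (hF : ∀ k, 0 ≤ F k) {r N : ℕ} (hrN : r ≤ N) :
    ∑ h ∈ Fintype.piFinset (fun _ : Fin d => Finset.Icc (-(N : ℤ)) N) \
        Fintype.piFinset (fun _ : Fin d => Finset.Icc (-(r : ℤ)) r), f h ≤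
      ∑ k ∈ Finset.Ioc r N, 2 * d * 3 ^ (d - 1) * (k : ℝ) ^ (d - 1) * F k := by
  induction N, hrN using Nat.le_induction with
  | base => simp
  | succ N hN ih =>
    have hsplit : Fintype.piFinset (fun _ : Fin d => Finset.Icc (-((N + 1 : ℕ) : ℤ)) (N + 1 : ℕ)) \
        Fintype.piFinset (fun _ : Fin d => Finset.Icc (-(r : ℤ)) r) =
        (Fintype.piFinset (fun _ : Fin d => Finset.Icc (-((N + 1 : ℕ) : ℤ)) (N + 1 : ℕ)) \
          Fintype.piFinset (fun _ : Fin d => Finset.Icc (-(N : ℤ)) N)) ∪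
        (Fintype.piFinset (fun _ : Fin d => Finset.Icc (-(N : ℤ)) N) \
          Fintype.piFinset (fun _ : Fin d => Finset.Icc (-(r : ℤ)) r)) :=
      (Finset.sdiff_union_sdiff_cancel (box_mono (Nat.le_succ N)) (box_mono hN)).symm
    have hdisj : Disjoint
        (Fintype.piFinset (fun _ : Fin d => Finset.Icc (-((N + 1 : ℕ) : ℤ)) (N + 1 : ℕ)) \
          Fintype.piFinset (fun _ : Fin d => Finset.Icc (-(N : ℤ)) N))
        (Fintype.piFinset (fun _ : Fin d => Finset.Icc (-(N : ℤ)) N) \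
          Fintype.piFinset (fun _ : Fin d => Finset.Icc (-(r : ℤ)) r)) := by
      rw [Finset.disjoint_left]
      intro h h1 h2
      exact (Finset.mem_sdiff.mp h1).2 (Finset.mem_sdiff.mp h2).1
    rw [hsplit, Finset.sum_union hdisj, Finset.sum_Ioc_succ_top hN, add_comm]
    refine add_le_add ih ?_
    -- the shell sum
    have hshell : ∀ h ∈ Fintype.piFinset (fun _ : Fin d => Finset.Icc (-((N + 1 : ℕ) : ℤ)) (N + 1 : ℕ)) \
        Fintype.piFinset (fun _ : Fin d => Finset.Icc (-(N : ℤ)) N), f h ≤ F (N + 1) := by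
      intro h hh
      rw [Finset.mem_sdiff] at hh
      exact hfF h (N + 1) (by omega) (by rw [norm_eq_of_mem_shell hh.1 hh.2]; push_cast; ring)
    calc ∑ h ∈ Fintype.piFinset (fun _ : Fin d => Finset.Icc (-((N + 1 : ℕ) : ℤ)) (N + 1 : ℕ)) \
          Fintype.piFinset (fun _ : Fin d => Finset.Icc (-(N : ℤ)) N), f h
        ≤ ∑ h ∈ Fintype.piFinset (fun _ : Fin d => Finset.Icc (-((N + 1 : ℕ) : ℤ)) (N + 1 : ℕ)) \
          Fintype.piFinset (fun _ : Fin d => Finset.Icc (-(N : ℤ)) N), F (N + 1) :=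
          Finset.sum_le_sum hshell
      _ = ((Fintype.piFinset (fun _ : Fin d => Finset.Icc (-((N + 1 : ℕ) : ℤ)) (N + 1 : ℕ)) \
          Fintype.piFinset (fun _ : Fin d => Finset.Icc (-(N : ℤ)) N)).card : ℝ) * F (N + 1) := by
          rw [Finset.sum_const, nsmul_eq_mul]
      _ ≤ 2 * d * 3 ^ (d - 1) * ((N + 1 : ℕ) : ℝ) ^ (d - 1) * F (N + 1) := by
          refine mul_le_mul_of_nonneg_right ?_ (hF _)
          have := card_shell_le (d := d) (k := N + 1) (by omega)
          simpa using this

/-- **Tail sums of the jump kernel.** For `t > d`, `r ≥ 1` and any finite set `s` of lattice points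
with `‖h‖ > r`: `∑_{h ∈ s} ‖h‖^{-t} ≤ (2 d 3^{d-1} / (t - d)) r^{d - t}`. [folklore] -/
theorem sum_norm_rpow_le_of_norm_gt (hd : 1 ≤ d) {t : ℝ} (ht : (d : ℝ) < t) {r : ℕ} (hr : 1 ≤ r)
    (s : Finset (Fin d → ℤ)) (hs : ∀ h ∈ s, (r : ℝ) < ‖h‖) :
    ∑ h ∈ s, ‖h‖ ^ (-t) ≤ 2 * d * 3 ^ (d - 1) / (t - d) * (r : ℝ) ^ ((d : ℝ) - t) := by
  obtain ⟨N, hN⟩ := exists_subset_box s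
  have hrN : r ≤ N ∨ N < r := le_or_gt r N
  -- s ⊆ box N \ box r
  have hsub : s ⊆ Fintype.piFinset (fun _ : Fin d => Finset.Icc (-(N : ℤ)) N) \
      Fintype.piFinset (fun _ : Fin d => Finset.Icc (-(r : ℤ)) r) := by
    intro h hh
    rw [Finset.mem_sdiff]
    refine ⟨hN hh, fun hr' => ?_⟩
    rw [mem_box_iff] at hr'
    exact absurd (hs h hh) (not_lt.mpr hr')
  have hpos : ∀ h : Fin d → ℤ, 0 ≤ ‖h‖ ^ (-t) := fun h => Real.rpow_nonneg (norm_nonneg _) _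
  have hta : 0 < t - d := by linarith
  rcases hrN with hrN | hrN
  · calc ∑ h ∈ s, ‖h‖ ^ (-t)
        ≤ ∑ h ∈ Fintype.piFinset (fun _ : Fin d => Finset.Icc (-(N : ℤ)) N) \
            Fintype.piFinset (fun _ : Fin d => Finset.Icc (-(r : ℤ)) r), ‖h‖ ^ (-t) :=
          Finset.sum_le_sum_of_subset_of_nonneg hsub (fun h _ _ => hpos h)
      _ ≤ ∑ k ∈ Finset.Ioc r N, 2 * d * 3 ^ (d - 1) * (k : ℝ) ^ (d - 1) * (k : ℝ) ^ (-t) := by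
          refine sum_box_sdiff_box_le (F := fun k => (k : ℝ) ^ (-t)) ?_
            (fun k => Real.rpow_nonneg (Nat.cast_nonneg k) _) hrN
          intro h k _ hk
          rw [hk]
      _ = 2 * d * 3 ^ (d - 1) * ∑ k ∈ Finset.Ioc r N, (k : ℝ) ^ (-1 - (t - d)) := by
          rw [Finset.mul_sum]
          refine Finset.sum_congr rfl fun k hk => ?_
          have hk0 : (0 : ℝ) < k := by
            have := (Finset.mem_Ioc.mp hk).1; exact_mod_cast (by omega : 0 < k)
          have : (k : ℝ) ^ (d - 1) * (k : ℝ) ^ (-t) = (k : ℝ) ^ (-1 - (t - d)) := by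
            rw [← Real.rpow_natCast, ← Real.rpow_add hk0]
            congr 1
            rw [Nat.cast_sub hd]
            push_cast
            ring
          rw [mul_assoc, this]
      _ ≤ 2 * d * 3 ^ (d - 1) * ((r : ℝ) ^ (-(t - d)) / (t - d)) :=
          mul_le_mul_of_nonneg_left (sum_Ioc_rpow_neg_le hta hr N) (by positivity)
      _ = 2 * d * 3 ^ (d - 1) / (t - d) * (r : ℝ) ^ ((d : ℝ) - t) := by
          rw [show -(t - d) = (d : ℝ) - t by ring]
          ring
  · -- then s is empty
    have hs0 : s = ∅ := by
      rw [Finset.eq_empty_iff_forall_notMem]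
      intro h hh
      have h1 := hsub hh
      rw [Finset.mem_sdiff, mem_box_iff, mem_box_iff] at h1
      exact h1.2 (h1.1.trans (by exact_mod_cast hrN.le))
    rw [hs0, Finset.sum_empty]
    positivity

/-- **Inner sums.** For `γ > -d`, `r ≥ 1` and any finite set `s` of nonzero lattice points with
`‖h‖ ≤ r`: `∑_{h ∈ s} ‖h‖^{γ} ≤ 2 d 3^{d-1} (1 + 1/(d+γ)) r^{d + γ}`. [folklore] -/
theorem sum_norm_rpow_le_of_norm_le (hd : 1 ≤ d) {γ : ℝ} (hγ : -(d : ℝ) < γ) (r : ℕ)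
    (s : Finset (Fin d → ℤ)) (hs : ∀ h ∈ s, h ≠ 0 ∧ ‖h‖ ≤ r) :
    ∑ h ∈ s, ‖h‖ ^ γ ≤ 2 * d * 3 ^ (d - 1) * (1 + 1 / (d + γ)) * (r : ℝ) ^ ((d : ℝ) + γ) := by
  have hsub : s ⊆ Fintype.piFinset (fun _ : Fin d => Finset.Icc (-(r : ℤ)) r) \
      Fintype.piFinset (fun _ : Fin d => Finset.Icc (-((0 : ℕ) : ℤ)) (0 : ℕ)) := by
    intro h hh
    rw [Finset.mem_sdiff, mem_box_iff, mem_box_iff]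
    refine ⟨(hs h hh).2, fun h0 => (hs h hh).1 ?_⟩
    have : ‖h‖ ≤ 0 := by exact_mod_cast h0
    exact norm_le_zero_iff.mp this
  have hpos : ∀ h : Fin d → ℤ, 0 ≤ ‖h‖ ^ γ := fun h => Real.rpow_nonneg (norm_nonneg _) _
  have he : -1 < (d : ℝ) - 1 + γ := by linarith
  calc ∑ h ∈ s, ‖h‖ ^ γ
      ≤ ∑ h ∈ Fintype.piFinset (fun _ : Fin d => Finset.Icc (-(r : ℤ)) r) \
          Fintype.piFinset (fun _ : Fin d => Finset.Icc (-((0 : ℕ) : ℤ)) (0 : ℕ)), ‖h‖ ^ γ :=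
        Finset.sum_le_sum_of_subset_of_nonneg hsub (fun h _ _ => hpos h)
    _ ≤ ∑ k ∈ Finset.Ioc 0 r, 2 * d * 3 ^ (d - 1) * (k : ℝ) ^ (d - 1) * (k : ℝ) ^ γ := by
        refine sum_box_sdiff_box_le (F := fun k => (k : ℝ) ^ γ) ?_
          (fun k => Real.rpow_nonneg (Nat.cast_nonneg k) _) (Nat.zero_le r)
        intro h k _ hk
        rw [hk]
    _ = 2 * d * 3 ^ (d - 1) * ∑ k ∈ Finset.Icc 1 r, (k : ℝ) ^ ((d : ℝ) - 1 + γ) := by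
        rw [Finset.mul_sum, show Finset.Ioc 0 r = Finset.Icc 1 r from rfl]
        refine Finset.sum_congr rfl fun k hk => ?_
        have hk0 : (0 : ℝ) < k := by
          have := (Finset.mem_Icc.mp hk).1; exact_mod_cast (by omega : 0 < k)
        have : (k : ℝ) ^ (d - 1) * (k : ℝ) ^ γ = (k : ℝ) ^ ((d : ℝ) - 1 + γ) := by
          rw [← Real.rpow_natCast, ← Real.rpow_add hk0]
          congr 1
          rw [Nat.cast_sub hd]
          push_cast
          ring
        rw [mul_assoc, this]
    _ ≤ 2 * d * 3 ^ (d - 1) * ((1 + 1 / ((d : ℝ) - 1 + γ + 1)) * (r : ℝ) ^ ((d : ℝ) - 1 + γ + 1)) :=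
        mul_le_mul_of_nonneg_left (sum_Icc_rpow_le he r) (by positivity)
    _ = 2 * d * 3 ^ (d - 1) * (1 + 1 / (d + γ)) * (r : ℝ) ^ ((d : ℝ) + γ) := by
        rw [show (d : ℝ) - 1 + γ + 1 = d + γ by ring]
        ring

/-- Boxes around an arbitrary centre: membership. [folklore] -/
theorem mem_box_add_iff (v h : Fin d → ℤ) (R : ℕ) :
    h ∈ (Fintype.piFinset (fun _ : Fin d => Finset.Icc (-(R : ℤ)) R)).map (Equiv.addRight v).toEmbedding
      ↔ ‖h - v‖ ≤ R := by
  rw [Finset.mem_map_equiv, ← mem_box_iff]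
  simp [Equiv.addRight, sub_eq_add_neg]

/-- Boxes around an arbitrary centre: cardinality `(2R+1)^d`. [folklore] -/
theorem card_box_add (v : Fin d → ℤ) (R : ℕ) :
    ((Fintype.piFinset (fun _ : Fin d => Finset.Icc (-(R : ℤ)) R)).map
      (Equiv.addRight v).toEmbedding).card = (2 * R + 1) ^ d := by
  rw [Finset.card_map, card_box]

/-- Any finite set of lattice points in the ball `‖h - v‖ ≤ R` has at most `(2R+1)^d` points.
[folklore] -/
theorem card_le_of_norm_sub_le (v : Fin d → ℤ) (R : ℕ) (s : Finset (Fin d → ℤ))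
    (hs : ∀ h ∈ s, ‖h - v‖ ≤ R) : s.card ≤ (2 * R + 1) ^ d := by
  rw [← card_box_add v R]
  exact Finset.card_le_card fun h hh => (mem_box_add_iff v h R).mpr (hs h hh)

/-- **Summability of the jump kernel**: for `t > d` the family `h ↦ ‖h‖^{-t}` (`h ≠ 0`) is
summable on `ℤ^d`, with sum at most `3^d + 2d3^{d-1}/(t-d)`. [folklore] -/
theorem summable_norm_rpow_neg (hd : 1 ≤ d) {t : ℝ} (ht : (d : ℝ) < t) :
    Summable (fun h : Fin d → ℤ => if h = 0 then (0 : ℝ) else ‖h‖ ^ (-t)) ∧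
      ∑' h : Fin d → ℤ, (if h = 0 then (0 : ℝ) else ‖h‖ ^ (-t)) ≤
        3 ^ d + 2 * d * 3 ^ (d - 1) / (t - d) := by
  have hnn : ∀ h : Fin d → ℤ, 0 ≤ (if h = 0 then (0 : ℝ) else ‖h‖ ^ (-t)) := by
    intro h; split_ifs
    · exact le_rfl
    · exact Real.rpow_nonneg (norm_nonneg _) _
  -- bound on finite partial sums: split at radius 1
  have hbound : ∀ u : Finset (Fin d → ℤ), ∑ h ∈ u, (if h = 0 then (0 : ℝ) else ‖h‖ ^ (-t)) ≤
      3 ^ d + 2 * d * 3 ^ (d - 1) / (t - d) := by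
    intro u
    classical
    have hsplit : ∑ h ∈ u, (if h = 0 then (0 : ℝ) else ‖h‖ ^ (-t)) =
        ∑ h ∈ u.filter (fun h => h ≠ 0 ∧ ‖h‖ ≤ 1), ‖h‖ ^ (-t) +
        ∑ h ∈ u.filter (fun h => (1 : ℝ) < ‖h‖), ‖h‖ ^ (-t) := by
      rw [← Finset.sum_filter_add_sum_filter_not u (fun h => h ≠ 0 ∧ ‖h‖ ≤ 1)]
      congr 1
      · refine Finset.sum_congr rfl fun h hh => ?_
        rw [Finset.mem_filter] at hh
        rw [if_neg hh.2.1]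
      · rw [← Finset.sum_filter_add_sum_filter_not (u.filter fun h => ¬(h ≠ 0 ∧ ‖h‖ ≤ 1))
          (fun h => h = 0)]
        have h0 : ∑ h ∈ (u.filter fun h => ¬(h ≠ 0 ∧ ‖h‖ ≤ 1)).filter (fun h => h = 0),
            (if h = 0 then (0 : ℝ) else ‖h‖ ^ (-t)) = 0 :=
          Finset.sum_eq_zero fun h hh => by rw [if_pos (Finset.mem_filter.mp hh).2]
        rw [h0, zero_add]
        have hset : (u.filter fun h => ¬(h ≠ 0 ∧ ‖h‖ ≤ 1)).filter (fun h => ¬h = 0) =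
            u.filter (fun h => (1 : ℝ) < ‖h‖) := by
          ext h
          simp only [Finset.mem_filter, not_and, not_le]
          constructor
          · rintro ⟨⟨hu, h1⟩, h2⟩; exact ⟨hu, h1 h2⟩
          · rintro ⟨hu, h1⟩
            have hne : h ≠ 0 := by
              intro h0; rw [h0, norm_zero] at h1; linarith
            exact ⟨⟨hu, fun _ => h1⟩, hne⟩
        rw [hset]
        refine Finset.sum_congr rfl fun h hh => ?_
        have h1 := (Finset.mem_filter.mp hh).2
        have hne : h ≠ 0 := by intro h0; rw [h0, norm_zero] at h1; linarith
        rw [if_neg hne]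
    rw [hsplit]
    -- points with 0 < ‖h‖ ≤ 1 have norm exactly 1; there are at most 3^d of them
    have hA : ∑ h ∈ u.filter (fun h => h ≠ 0 ∧ ‖h‖ ≤ 1), ‖h‖ ^ (-t) ≤ 3 ^ d := by
      have hone : ∀ h ∈ u.filter (fun h => h ≠ 0 ∧ ‖h‖ ≤ 1), ‖h‖ ^ (-t) = 1 := by
        intro h hh
        have hh' := (Finset.mem_filter.mp hh).2
        have : ‖h‖ = 1 := le_antisymm hh'.2 (one_le_norm_of_ne_zero hh'.1)
        rw [this, Real.one_rpow]
      rw [Finset.sum_congr rfl hone, Finset.sum_const, nsmul_eq_mul, mul_one]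
      have hc := card_le_of_norm_sub_le (0 : Fin d → ℤ) 1 (u.filter (fun h => h ≠ 0 ∧ ‖h‖ ≤ 1))
        (fun h hh => by
          have := (Finset.mem_filter.mp hh).2.2
          simpa using this)
      have : ((u.filter (fun h => h ≠ 0 ∧ ‖h‖ ≤ 1)).card : ℝ) ≤ ((2 * 1 + 1) ^ d : ℕ) := by
        exact_mod_cast hc
      simpa using this
    have hB := sum_norm_rpow_le_of_norm_gt hd ht (r := 1) le_rfl
      (u.filter (fun h => (1 : ℝ) < ‖h‖)) (fun h hh => by
        have := (Finset.mem_filter.mp hh).2; exact_mod_cast this)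
    simp only [Nat.cast_one, Real.one_rpow, mul_one] at hB
    exact add_le_add hA hB
  exact ⟨summable_of_sum_le hnn hbound, Real.tsum_le_of_sum_le hnn hbound⟩

end Norm

end Literature.Probability.Process
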